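import Literature.NumberTheory.Automorphic.ShellSmoothingGL2
import Literature.NumberTheory.Automorphic.SmoothedFormWhittakerLine
import Literature.NumberTheory.Automorphic.WhittakerCoeffLocalDatum
import HarnessLib

/-!
# The Whittaker coefficient of the shell smoothing: the `Λ`-identity and the vanishing shells

Topic `NumberTheory/Automorphic`; namespace `Literature.NumberTheory.Automorphic`. Groundwork for the
finite-place half of the Kirillov `L²`-bound of the smoothed Whittaker coefficient on `GL_2` (the
`n ≤ 2` case of the named fact `JacquetShalika1981_partialPairL_pole_of_eq_conj`), Whittaker layer
(theorems only).

Let `D` be a shell datum at the finite place `v` (`ShellSmoothingGL2`), `θ` a test function on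
`GL_2(𝔸_K)`, `f ∈ L²`, `Φ = invQuot (S_θ f)` the smoothed form as a left `GL_2(K)`-invariant function,
`W_Φ` its global Whittaker coefficient for Tate's character and box (`whittakerCoeff`). We PROVE:

* `whittakerCoeff_sum_smul_of_continuous` — finite linear combinations of continuous functions pass
  to `W` (integrability on the relatively compact Tate box);
* `whittakerCoeff_shellRe_add_shellIm` — **the complexified shell smoothing**:
  `W_{invQuot S_{Re(e_J⋆θ)} f}(g) + i W_{invQuot S_{Im(e_J⋆θ)} f}(g) = ∑_q c_q W_Φ(g ι_v(j_q))`;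
* `sum_coef_mul_whittakerCoeff_eq` — **the `Λ`-identity**: if `θ` is left invariant under the
  lower-triangular elements of `ι_v(J)` then `∑_q c_q W_Φ(g ι_v(j_q)) = W_Φ(g)` for every `g` with
  trivial `v`-component (Iwahori factorisation `j_q = n(x_q) b_q`, `N(𝔸)`-equivariance
  `W_Φ(n g) = ψ(n) W_Φ(g)`, `ψ_v(x_q) χ̄_v(j_q) = 1` and `∑ m_q = 1`); hence
  `W_Φ(g) = W_{Re}(g) + i W_{Im}(g)` and `|W_Φ(g)|² ≤ 2 |W_{Re}(g)|² + 2 |W_{Im}(g)|²`;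
* `whittakerCoeff_eq_zero_of_upper_invariant` — **vanishing shells**: if `θ` is left invariant under
  `ι_v(n(y))` for some `y` with `ψ_v(y) ≠ 1`, then `W_Φ(g) = 0` for all `g` trivial at `v`.

(Jacquet–Shalika (1981), §4–§5; Bump (1997), §4.4; Cogdell (2004), §1.1.) No named facts.

## References

* H. Jacquet, J. A. Shalika, *On Euler products and the classification of automorphic
  representations I*, Amer. J. Math. 103 (1981), §4–§5 [JacquetShalikaAJM1981].
* D. Bump, *Automorphic Forms and Representations*, CUP (1997), §4.4 [Bump1997].
* J. W. Cogdell, *Analytic theory of L-functions for GL_n*, in *An Introduction to the Langlands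
  Program* (2004), §1.1 [CogdellAnalyticTheory2004].
-/

noncomputable section

open scoped MatrixGroups Classical ComplexConjugate
open WithZero NumberField NumberField.mixedEmbedding IsDedekindDomain MeasureTheory Complex

namespace Literature.NumberTheory.Automorphic

open ShellGL2

variable {K : Type} [Field K] [NumberField K] {v : HeightOneSpectrum (𝓞 K)}
  {μ : Measure (AdelicGroupData.gl 2 K).automorphicQuotient} [(AdelicGroupData.gl 2 K).IsAutomorphicMeasure μ]

attribute [local instance] adelicBorel borelSpace_adelic locallyCompactSpace_adelic
  secondCountableTopology_gl_adelic

section Linear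

variable [MeasurableSpace ↥(adelicUnipotent 2 K)] [BorelSpace ↥(adelicUnipotent 2 K)]

/-- **Finite linear combinations of continuous functions pass to the Whittaker coefficient** (Tate's
box has compact closure, so the integrands are integrable). [folklore] -/
theorem whittakerCoeff_sum_smul_of_continuous (ν : Measure ↥(adelicUnipotent 2 K)) [IsFiniteMeasureOnCompacts ν] {ι' : Type*}
    (s : Finset ι') (c : ι' → ℂ) {φ : ι' → GL (Fin 2) (AdeleRing (𝓞 K) K) → ℂ} (hφ : ∀ i ∈ s, Continuous (φ i))
    (g : GL (Fin 2) (AdeleRing (𝓞 K) K)) :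
    whittakerCoeff ν (unipotentTateDomain 2 K) (adeleAddChar K) (∑ i ∈ s, c i • φ i) g =
      ∑ i ∈ s, c i * whittakerCoeff ν (unipotentTateDomain 2 K) (adeleAddChar K) (φ i) g := by
  classical
  have hψc : Continuous (adeleAddChar K) := (isGlobalAddChar_adeleAddChar (K := K)).continuous
  induction s using Finset.induction_on with
  | empty => simp
  | insert a s ha ih =>
    have hs : ∀ i ∈ s, Continuous (φ i) := fun i hi => hφ i (Finset.mem_insert_of_mem hi)
    have hcs : Continuous (∑ i ∈ s, c i • φ i) := by
      rw [Finset.sum_fn]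
      exact continuous_finsetSum s fun i hi => (hs i hi).const_smul (c i)
    rw [Finset.sum_insert ha, Finset.sum_insert ha,
      whittakerCoeff_add ν _ _ g
        (integrableOn_whittakerIntegrand_of_continuous isCompact_closure_unipotentTateDomain hψc
          ((hφ a (Finset.mem_insert_self a s)).const_smul (c a)) g)
        (integrableOn_whittakerIntegrand_of_continuous isCompact_closure_unipotentTateDomain hψc hcs g),
      whittakerCoeff_const_smul, ih hs]

end Linear

namespace ShellDatum

variable (D : ShellDatum K v)
variable [MeasurableSpace (GL (Fin 2) (v.adicCompletion K))] [BorelSpace (GL (Fin 2) (v.adicCompletion K))]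
variable [MeasurableSpace ↥(adelicUnipotent 2 K)] [BorelSpace ↥(adelicUnipotent 2 K)]

omit D [MeasurableSpace (GL (Fin 2) (v.adicCompletion K))] [BorelSpace (GL (Fin 2) (v.adicCompletion K))]
  [MeasurableSpace ↥(adelicUnipotent 2 K)] [BorelSpace ↥(adelicUnipotent 2 K)] in
/-- The smoothed form `invQuot (S_θ f)` is continuous for a test function `θ`. [folklore] -/
theorem continuous_invQuot_smoothedForm {θ : (AdelicGroupData.gl 2 K).Adelic → ℝ} (hθ : IsTestFunctionGL 2 K θ) (f : (AdelicGroupData.gl 2 K).L2 μ) :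
    Continuous (invQuot (AdelicGroupData.gl 2 K) (smoothedForm θ f)) :=
  (continuous_smoothedForm hθ.continuous hθ.hasCompactSupport f).comp
    ((AdelicGroupData.gl 2 K).continuous_toAutomorphicQuotient.comp continuous_inv)

omit [MeasurableSpace ↥(adelicUnipotent 2 K)] [BorelSpace ↥(adelicUnipotent 2 K)] in
/-- **The complexified smoothed form, pointwise**:
`invQuot S_{Re(e_J⋆θ)} f (x) + i invQuot S_{Im(e_J⋆θ)} f (x) = ∑_q c_q invQuot S_θ f (x ι_v(j_q))`. [folklore] -/
theorem invQuot_smoothedForm_shellRe_add_shellIm {θ : (AdelicGroupData.gl 2 K).Adelic → ℝ} (hθ : IsTestFunctionGL 2 K θ)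
    (f : (AdelicGroupData.gl 2 K).L2 μ) (x : GL (Fin 2) (AdeleRing (𝓞 K) K)) :
    invQuot (AdelicGroupData.gl 2 K) (smoothedForm (D.shellRe θ) f) x + I * invQuot (AdelicGroupData.gl 2 K) (smoothedForm (D.shellIm θ) f) x =
      ∑ q, D.coef q * invQuot (AdelicGroupData.gl 2 K) (smoothedForm θ f) (x * GLn.ofLocal 2 K v (D.rep q)) := by
  have hc : ∀ q, Continuous (leftTranslateWeight (n := 2) (GLn.toAdelic 2 K v (D.rep q)) θ) := fun q =>
    continuous_leftTranslateWeight hθ.continuous _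
  have hs : ∀ q, HasCompactSupport (leftTranslateWeight (n := 2) (GLn.toAdelic 2 K v (D.rep q)) θ) := fun q =>
    hasCompactSupport_leftTranslateWeight hθ.hasCompactSupport _
  have hRe := (smoothedForm_sum_smul_weight (μ := μ) Finset.univ (fun q => (D.coef q).re) (fun q _ => hc q) (fun q _ => hs q)).2.2 f
  have hIm := (smoothedForm_sum_smul_weight (μ := μ) Finset.univ (fun q => (D.coef q).im) (fun q _ => hc q) (fun q _ => hs q)).2.2 f
  rw [invQuot_apply, invQuot_apply, shellRe_eq_sum, shellIm_eq_sum, hRe, hIm, Finset.mul_sum, ← Finset.sum_add_distrib]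
  refine Finset.sum_congr rfl fun q _ => ?_
  have e : invQuot (AdelicGroupData.gl 2 K) (smoothedForm θ f) (x * GLn.ofLocal 2 K v (D.rep q)) =
      smoothedForm (leftTranslateWeight (n := 2) (GLn.toAdelic 2 K v (D.rep q)) θ) f ((AdelicGroupData.gl 2 K).toAutomorphicQuotient x⁻¹) :=
    invQuot_smoothedForm_mul (μ := μ) θ f x (GLn.toAdelic 2 K v (D.rep q))
  rw [e, ← mul_assoc, ← add_mul]
  congr 1
  rw [mul_comm I]
  exact Complex.re_add_im _

/-- **The Whittaker coefficient of the complexified shell smoothing**: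
`W_{Re}(g) + i W_{Im}(g) = ∑_q c_q W_Φ(g ι_v(j_q))`, `Φ = invQuot S_θ f`. [cite: Bump1997, §4.4] -/
theorem whittakerCoeff_shellRe_add_shellIm (ν : Measure ↥(adelicUnipotent 2 K)) [IsFiniteMeasureOnCompacts ν]
    {θ : (AdelicGroupData.gl 2 K).Adelic → ℝ} (hθ : IsTestFunctionGL 2 K θ) (f : (AdelicGroupData.gl 2 K).L2 μ) (g : GL (Fin 2) (AdeleRing (𝓞 K) K)) :
    whittakerCoeff ν (unipotentTateDomain 2 K) (adeleAddChar K) (invQuot (AdelicGroupData.gl 2 K) (smoothedForm (D.shellRe θ) f)) g +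
      I * whittakerCoeff ν (unipotentTateDomain 2 K) (adeleAddChar K) (invQuot (AdelicGroupData.gl 2 K) (smoothedForm (D.shellIm θ) f)) g =
      ∑ q, D.coef q * whittakerCoeff ν (unipotentTateDomain 2 K) (adeleAddChar K) (invQuot (AdelicGroupData.gl 2 K) (smoothedForm θ f))
        (g * GLn.ofLocal 2 K v (D.rep q)) := by
  have hψc : Continuous (adeleAddChar K) := (isGlobalAddChar_adeleAddChar (K := K)).continuous
  have hcRe := continuous_invQuot_smoothedForm (μ := μ) (D.isTestFunctionGL_shellRe hθ) f
  have hcIm := continuous_invQuot_smoothedForm (μ := μ) (D.isTestFunctionGL_shellIm hθ) f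
  have hcθ := continuous_invQuot_smoothedForm (μ := μ) hθ f
  set Φ : GL (Fin 2) (AdeleRing (𝓞 K) K) → ℂ := invQuot (AdelicGroupData.gl 2 K) (smoothedForm θ f) with hΦ
  set φ₁ : GL (Fin 2) (AdeleRing (𝓞 K) K) → ℂ := invQuot (AdelicGroupData.gl 2 K) (smoothedForm (D.shellRe θ) f) with hφ₁
  set φ₂ : GL (Fin 2) (AdeleRing (𝓞 K) K) → ℂ := invQuot (AdelicGroupData.gl 2 K) (smoothedForm (D.shellIm θ) f) with hφ₂
  -- the combination as one function
  have hL := whittakerCoeff_add ν (unipotentTateDomain 2 K) (adeleAddChar K) (φ₁ := φ₁) (φ₂ := I • φ₂) g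
    (integrableOn_whittakerIntegrand_of_continuous isCompact_closure_unipotentTateDomain hψc hcRe g)
    (integrableOn_whittakerIntegrand_of_continuous isCompact_closure_unipotentTateDomain hψc (hcIm.const_smul I) g)
  rw [whittakerCoeff_const_smul] at hL
  have hF : φ₁ + I • φ₂ = ∑ q, D.coef q • fun x : GL (Fin 2) (AdeleRing (𝓞 K) K) => Φ (x * GLn.ofLocal 2 K v (D.rep q)) := by
    funext x
    simp only [Pi.add_apply, Pi.smul_apply, smul_eq_mul, Finset.sum_apply]
    exact D.invQuot_smoothedForm_shellRe_add_shellIm hθ f x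
  rw [← hL, hF, whittakerCoeff_sum_smul_of_continuous ν Finset.univ D.coef
    (φ := fun q (x : GL (Fin 2) (AdeleRing (𝓞 K) K)) => Φ (x * GLn.ofLocal 2 K v (D.rep q)))
    (fun q _ => hcθ.comp (continuous_id.mul continuous_const)) g]
  refine Finset.sum_congr rfl fun q _ => ?_
  rw [← whittakerCoeff_mul_right]

/-! ### The `Λ`-identity -/

/-- `θ` is left invariant under the lower-triangular elements of `ι_v(J)`. [folklore] -/
def IsLeftLowerInvariant (θ : (AdelicGroupData.gl 2 K).Adelic → ℝ) : Prop :=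
  ∀ b : GL (Fin 2) (v.adicCompletion K), ShellCond D.r D.c b → ent b 0 1 = 0 →
    ∀ h : (AdelicGroupData.gl 2 K).Adelic, θ (GLn.toAdelic 2 K v b * h) = θ h

omit [MeasurableSpace (GL (Fin 2) (v.adicCompletion K))] [BorelSpace (GL (Fin 2) (v.adicCompletion K))]
  [MeasurableSpace ↥(adelicUnipotent 2 K)] [BorelSpace ↥(adelicUnipotent 2 K)] [(AdelicGroupData.gl 2 K).IsAutomorphicMeasure μ] in
/-- `ψ_v(x_q) χ̄_v(j_q) = 1` for the Iwahori coordinate `x_q` of `j_q ∈ J`. [folklore] -/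
theorem adicComponent_mul_conj_shellChar {j : GL (Fin 2) (v.adicCompletion K)} (hj : ShellCond D.r D.c j) :
    ((((adeleAddChar K).adicComponent v) (ent j 0 1 * (ent j 1 1)⁻¹) : Circle) : ℂ) * conj (shellChar K v j) = 1 := by
  obtain ⟨-, -, -, -, -, -, hlast⟩ := shell_factorisation D.hc hj
  have h1 : ((adeleAddChar K).adicComponent v) (ent j 0 1) = ((adeleAddChar K).adicComponent v) (ent j 0 1 * (ent j 1 1)⁻¹) := by
    have := AddChar.map_sub_eq_div ((adeleAddChar K).adicComponent v) (ent j 0 1) (ent j 0 1 * (ent j 1 1)⁻¹)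
    rw [D.hψ _ hlast] at this
    exact (div_eq_one.1 this.symm)
  rw [shellChar_apply, h1, ← Circle.coe_inv_eq_conj, ← Circle.coe_mul, mul_inv_cancel, Circle.coe_one]

omit D [MeasurableSpace (GL (Fin 2) (v.adicCompletion K))] [BorelSpace (GL (Fin 2) (v.adicCompletion K))]
  [MeasurableSpace ↥(adelicUnipotent 2 K)] [BorelSpace ↥(adelicUnipotent 2 K)] [(AdelicGroupData.gl 2 K).IsAutomorphicMeasure μ] in
/-- Left invariance of a weight under `ι_v(b)` makes `Φ = invQuot S_θ f` right `ι_v(b)`-invariant. [folklore] -/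
theorem invQuot_smoothedForm_mul_ofLocal_of_invariant {θ : (AdelicGroupData.gl 2 K).Adelic → ℝ} {b : GL (Fin 2) (v.adicCompletion K)}
    (hb : ∀ h : (AdelicGroupData.gl 2 K).Adelic, θ (GLn.toAdelic 2 K v b⁻¹ * h) = θ h) (f : (AdelicGroupData.gl 2 K).L2 μ)
    (y : GL (Fin 2) (AdeleRing (𝓞 K) K)) :
    invQuot (AdelicGroupData.gl 2 K) (smoothedForm θ f) (y * GLn.ofLocal 2 K v b) = invQuot (AdelicGroupData.gl 2 K) (smoothedForm θ f) y := by
  have e : leftTranslateWeight (n := 2) (GLn.toAdelic 2 K v b) θ = θ := by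
    funext h
    rw [leftTranslateWeight_apply, ← map_inv, hb]
  have h := invQuot_smoothedForm_mul (μ := μ) θ f y (GLn.toAdelic 2 K v b)
  rw [e] at h
  exact h

omit [(AdelicGroupData.gl 2 K).IsAutomorphicMeasure μ] in
/-- **The `Λ`-identity**: for `θ` left invariant under the lower-triangular part of `ι_v(J)` and `g`
trivial at `v`, `∑_q c_q W_Φ(g ι_v(j_q)) = W_Φ(g)`, `Φ = invQuot S_θ f`. [cite: JacquetShalikaAJM1981, §5]
[cite: Bump1997, §4.4] -/
theorem sum_coef_mul_whittakerCoeff_eq (ν : Measure ↥(adelicUnipotent 2 K)) [Measure.IsHaarMeasure ν]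
    {θ : (AdelicGroupData.gl 2 K).Adelic → ℝ} (hθB : D.IsLeftLowerInvariant θ) (f : (AdelicGroupData.gl 2 K).L2 μ)
    {g : GL (Fin 2) (AdeleRing (𝓞 K) K)} (hg : GLn.toLocalAt 2 K v g = 1) :
    ∑ q, D.coef q * whittakerCoeff ν (unipotentTateDomain 2 K) (adeleAddChar K) (invQuot (AdelicGroupData.gl 2 K) (smoothedForm θ f))
        (g * GLn.ofLocal 2 K v (D.rep q)) =
      whittakerCoeff ν (unipotentTateDomain 2 K) (adeleAddChar K) (invQuot (AdelicGroupData.gl 2 K) (smoothedForm θ f)) g := by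
  have hψ : IsGlobalAddChar K (adeleAddChar K) := isGlobalAddChar_adeleAddChar (K := K)
  have h𝓕 : IsFundamentalDomain ↥(rationalUnipotent 2 K) (unipotentTateDomain 2 K) ν := isFundamentalDomain_unipotentTateDomain ν
  haveI := isMulRightInvariant_of_isHaarMeasure_adelicUnipotent ν
  set Φ : GL (Fin 2) (AdeleRing (𝓞 K) K) → ℂ := invQuot (AdelicGroupData.gl 2 K) (smoothedForm θ f) with hΦ
  have hΦinv : IsLeftInvariant (AdelicGroupData.gl 2 K) Φ := isLeftInvariant_invQuot _ _
  -- each shell: `c_q W_Φ(g ι(j_q)) = m_q W_Φ(g)`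
  have hq : ∀ q, D.coef q * whittakerCoeff ν (unipotentTateDomain 2 K) (adeleAddChar K) Φ (g * GLn.ofLocal 2 K v (D.rep q)) =
      (D.mass q : ℂ) * whittakerCoeff ν (unipotentTateDomain 2 K) (adeleAddChar K) Φ g := by
    intro q
    have hjm : ShellCond D.r D.c (D.rep q) := D.rep_mem q
    obtain ⟨hfac, hx, hb01, -, -, -, -⟩ := shell_factorisation D.hc hjm
    set j := D.rep q with hj
    set x : v.adicCompletion K := ent j 0 1 * (ent j 1 1)⁻¹ with hxdef
    set b := Matrix.GeneralLinearGroup.upperRightHom (-x) * j with hbdef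
    have hbJ : ShellCond D.r D.c b :=
      shellCond_mul D.hc (n_mem_shellSubgroup (hc := D.hc) (by rw [Valuation.map_neg]; exact hx)) hjm
    have hbinvJ : ShellCond D.r D.c b⁻¹ := shellCond_inv D.hc hbJ
    have hb01' : ent b⁻¹ 0 1 = 0 := by rw [(ent_inv b).2.1, hb01, mul_zero, neg_zero]
    -- `g ι(j) = ι(n(x)) (g ι(b))`
    have hcomm : g * GLn.ofLocal 2 K v j = GLn.ofLocal 2 K v (Matrix.GeneralLinearGroup.upperRightHom x) * (g * GLn.ofLocal 2 K v b) := by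
      have hc : GLn.ofLocal 2 K v (Matrix.GeneralLinearGroup.upperRightHom x) * g = g * GLn.ofLocal 2 K v (Matrix.GeneralLinearGroup.upperRightHom x) :=
        GLn.toAdelic_mul_eq_mul_toAdelic (n := 2) (K := K) (v := v) hg _
      rw [← mul_assoc, hc, mul_assoc, ← map_mul, ← hfac]
    -- `ι(n(x))` is unipotent with character value `ψ_v(x)`
    have hmem : GLn.ofLocal 2 K v (Matrix.GeneralLinearGroup.upperRightHom x) ∈ adelicUnipotent 2 K :=
      ofLocal_mem_adelicUnipotent (upperRightHom_mem_upperUnitriangular x)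
    have hchar : whittakerCharFun (adeleAddChar K) ⟨GLn.ofLocal 2 K v (Matrix.GeneralLinearGroup.upperRightHom x), hmem⟩ =
        ((adeleAddChar K).adicComponent v) x :=
      (whittakerCharFun_ofLocal (n := 2) (adeleAddChar K) (unipotentGL2 x)).trans (whittakerCharFun_unipotentGL2 _ x)
    -- `W_Φ(g ι(b)) = W_Φ(g)`
    have hbinv : ∀ y : GL (Fin 2) (AdeleRing (𝓞 K) K), Φ (y * GLn.ofLocal 2 K v b) = Φ y := fun y =>
      invQuot_smoothedForm_mul_ofLocal_of_invariant (μ := μ) (hθB _ hbinvJ hb01') f y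
    have h1 := whittakerCoeff_unipotent_mul (ν := ν) (𝓕 := unipotentTateDomain 2 K) (ψ := adeleAddChar K) h𝓕 hψ hΦinv
      ⟨_, hmem⟩ (g * GLn.ofLocal 2 K v b)
    rw [hcomm, h1, hchar, whittakerCoeff_mul_of_forall ν _ _ hbinv, ← mul_assoc, coef, mul_assoc (D.mass q : ℂ), mul_comm (conj _),
      D.adicComponent_mul_conj_shellChar hjm, mul_one]
  simp_rw [hq]
  rw [← Finset.sum_mul, ← Complex.ofReal_sum, D.sum_mass, Complex.ofReal_one, one_mul]

/-- Hence **`W_Φ(g) = W_{Re}(g) + i W_{Im}(g)`** for `g` trivial at `v`. [folklore] -/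
theorem whittakerCoeff_eq_shellRe_add_shellIm (ν : Measure ↥(adelicUnipotent 2 K)) [Measure.IsHaarMeasure ν]
    {θ : (AdelicGroupData.gl 2 K).Adelic → ℝ} (hθ : IsTestFunctionGL 2 K θ) (hθB : D.IsLeftLowerInvariant θ) (f : (AdelicGroupData.gl 2 K).L2 μ)
    {g : GL (Fin 2) (AdeleRing (𝓞 K) K)} (hg : GLn.toLocalAt 2 K v g = 1) :
    whittakerCoeff ν (unipotentTateDomain 2 K) (adeleAddChar K) (invQuot (AdelicGroupData.gl 2 K) (smoothedForm θ f)) g =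
      whittakerCoeff ν (unipotentTateDomain 2 K) (adeleAddChar K) (invQuot (AdelicGroupData.gl 2 K) (smoothedForm (D.shellRe θ) f)) g +
        I * whittakerCoeff ν (unipotentTateDomain 2 K) (adeleAddChar K) (invQuot (AdelicGroupData.gl 2 K) (smoothedForm (D.shellIm θ) f)) g := by
  rw [D.whittakerCoeff_shellRe_add_shellIm ν hθ f g, D.sum_coef_mul_whittakerCoeff_eq ν hθB f hg]

/-- **`|W_Φ(g)|² ≤ 2 |W_{Re}(g)|² + 2 |W_{Im}(g)|²`** for `g` trivial at `v`. [folklore] -/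
theorem norm_sq_whittakerCoeff_le_shell (ν : Measure ↥(adelicUnipotent 2 K)) [Measure.IsHaarMeasure ν]
    {θ : (AdelicGroupData.gl 2 K).Adelic → ℝ} (hθ : IsTestFunctionGL 2 K θ) (hθB : D.IsLeftLowerInvariant θ) (f : (AdelicGroupData.gl 2 K).L2 μ)
    {g : GL (Fin 2) (AdeleRing (𝓞 K) K)} (hg : GLn.toLocalAt 2 K v g = 1) :
    ‖whittakerCoeff ν (unipotentTateDomain 2 K) (adeleAddChar K) (invQuot (AdelicGroupData.gl 2 K) (smoothedForm θ f)) g‖ ^ 2 ≤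
      2 * ‖whittakerCoeff ν (unipotentTateDomain 2 K) (adeleAddChar K) (invQuot (AdelicGroupData.gl 2 K) (smoothedForm (D.shellRe θ) f)) g‖ ^ 2 +
        2 * ‖whittakerCoeff ν (unipotentTateDomain 2 K) (adeleAddChar K) (invQuot (AdelicGroupData.gl 2 K) (smoothedForm (D.shellIm θ) f)) g‖ ^ 2 := by
  rw [D.whittakerCoeff_eq_shellRe_add_shellIm ν hθ hθB f hg]
  set a := whittakerCoeff ν (unipotentTateDomain 2 K) (adeleAddChar K) (invQuot (AdelicGroupData.gl 2 K) (smoothedForm (D.shellRe θ) f)) g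
  set b := whittakerCoeff ν (unipotentTateDomain 2 K) (adeleAddChar K) (invQuot (AdelicGroupData.gl 2 K) (smoothedForm (D.shellIm θ) f)) g
  have h1 : ‖a + I * b‖ ≤ ‖a‖ + ‖b‖ := (norm_add_le _ _).trans (by rw [norm_mul, Complex.norm_I, one_mul])
  calc ‖a + I * b‖ ^ 2 ≤ (‖a‖ + ‖b‖) ^ 2 := pow_le_pow_left₀ (norm_nonneg _) h1 2
    _ ≤ 2 * ‖a‖ ^ 2 + 2 * ‖b‖ ^ 2 := by nlinarith [sq_nonneg (‖a‖ - ‖b‖)]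

/-! ### Vanishing shells -/

omit D [(AdelicGroupData.gl 2 K).IsAutomorphicMeasure μ] [MeasurableSpace (GL (Fin 2) (v.adicCompletion K))] [BorelSpace (GL (Fin 2) (v.adicCompletion K))] in
/-- **Vanishing**: if `θ` is left invariant under `ι_v(n(y))` with `ψ_v(y) ≠ 1`, then `W_Φ(g) = 0` for
every `g` trivial at `v` (`W_Φ(g) = W_Φ(g ι(n(y))) = ψ_v(y) W_Φ(g)`). [cite: JacquetShalikaAJM1981, §5] -/
theorem _root_.Literature.NumberTheory.Automorphic.whittakerCoeff_eq_zero_of_upper_invariant (ν : Measure ↥(adelicUnipotent 2 K)) [Measure.IsHaarMeasure ν]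
    {θ : (AdelicGroupData.gl 2 K).Adelic → ℝ} {y : v.adicCompletion K} (hy : (adeleAddChar K).adicComponent v y ≠ 1)
    (hθy : ∀ h : (AdelicGroupData.gl 2 K).Adelic, θ (GLn.toAdelic 2 K v (Matrix.GeneralLinearGroup.upperRightHom y) * h) = θ h)
    (f : (AdelicGroupData.gl 2 K).L2 μ) {g : GL (Fin 2) (AdeleRing (𝓞 K) K)} (hg : GLn.toLocalAt 2 K v g = 1) :
    whittakerCoeff ν (unipotentTateDomain 2 K) (adeleAddChar K) (invQuot (AdelicGroupData.gl 2 K) (smoothedForm θ f)) g = 0 := by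
  have hψ : IsGlobalAddChar K (adeleAddChar K) := isGlobalAddChar_adeleAddChar (K := K)
  have h𝓕 : IsFundamentalDomain ↥(rationalUnipotent 2 K) (unipotentTateDomain 2 K) ν := isFundamentalDomain_unipotentTateDomain ν
  haveI := isMulRightInvariant_of_isHaarMeasure_adelicUnipotent ν
  set Φ : GL (Fin 2) (AdeleRing (𝓞 K) K) → ℂ := invQuot (AdelicGroupData.gl 2 K) (smoothedForm θ f) with hΦ
  have hΦinv : IsLeftInvariant (AdelicGroupData.gl 2 K) Φ := isLeftInvariant_invQuot _ _
  -- `n(-y)⁻¹ = n(y)`, so `θ` is left invariant under `ι(n(-y)⁻¹)`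
  have hθ' : ∀ h : (AdelicGroupData.gl 2 K).Adelic, θ (GLn.toAdelic 2 K v (Matrix.GeneralLinearGroup.upperRightHom (-y))⁻¹ * h) = θ h := by
    intro h
    rw [AddChar.map_neg_eq_inv, inv_inv]
    exact hθy h
  have hinv : ∀ z : GL (Fin 2) (AdeleRing (𝓞 K) K), Φ (z * GLn.ofLocal 2 K v (Matrix.GeneralLinearGroup.upperRightHom (-y))) = Φ z := fun z =>
    invQuot_smoothedForm_mul_ofLocal_of_invariant (μ := μ) hθ' f z
  -- also right invariance under `ι(n(y)) = ι(n(-y))⁻¹`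
  have hinv' : ∀ z : GL (Fin 2) (AdeleRing (𝓞 K) K), Φ (z * GLn.ofLocal 2 K v (Matrix.GeneralLinearGroup.upperRightHom y)) = Φ z := by
    intro z
    have h := hinv (z * GLn.ofLocal 2 K v (Matrix.GeneralLinearGroup.upperRightHom y))
    rw [mul_assoc, ← map_mul, ← AddChar.map_add_eq_mul, add_neg_cancel, AddChar.map_zero_eq_one, map_one, mul_one] at h
    exact h.symm
  set u := GLn.ofLocal 2 K v (Matrix.GeneralLinearGroup.upperRightHom y) with hu
  have hmem : u ∈ adelicUnipotent 2 K := ofLocal_mem_adelicUnipotent (upperRightHom_mem_upperUnitriangular y)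
  have hchar : whittakerCharFun (adeleAddChar K) ⟨u, hmem⟩ = ((adeleAddChar K).adicComponent v) y :=
    (whittakerCharFun_ofLocal (n := 2) (adeleAddChar K) (unipotentGL2 y)).trans (whittakerCharFun_unipotentGL2 _ y)
  have hcomm : g * u = u * g := (GLn.toAdelic_mul_eq_mul_toAdelic (n := 2) (K := K) (v := v) hg _).symm
  have h2 := whittakerCoeff_unipotent_mul (ν := ν) (𝓕 := unipotentTateDomain 2 K) (ψ := adeleAddChar K) h𝓕 hψ hΦinv ⟨u, hmem⟩ g
  have h3 : whittakerCoeff ν (unipotentTateDomain 2 K) (adeleAddChar K) Φ g =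
      ((((adeleAddChar K).adicComponent v) y : Circle) : ℂ) * whittakerCoeff ν (unipotentTateDomain 2 K) (adeleAddChar K) Φ g := by
    rw [← hchar, ← h2]
    show whittakerCoeff ν (unipotentTateDomain 2 K) (adeleAddChar K) Φ g = whittakerCoeff ν (unipotentTateDomain 2 K) (adeleAddChar K) Φ (u * g)
    rw [← hcomm, whittakerCoeff_mul_of_forall ν _ _ hinv']
  have h4 : (1 - ((((adeleAddChar K).adicComponent v) y : Circle) : ℂ)) * whittakerCoeff ν (unipotentTateDomain 2 K) (adeleAddChar K) Φ g = 0 := by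
    rw [sub_mul, one_mul, ← h3, sub_self]
  rcases mul_eq_zero.1 h4 with h5 | h5
  · exfalso
    apply hy
    have h6 : ((((adeleAddChar K).adicComponent v) y : Circle) : ℂ) = ((1 : Circle) : ℂ) := by
      rw [Circle.coe_one]; exact (sub_eq_zero.1 h5).symm
    exact Subtype.ext h6
  · exact h5

end ShellDatum

end Literature.NumberTheory.Automorphic
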